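import Summits.BirchSwinnertonDyer.BirchSwinnertonDyer.Theorems.ByReductionTypeAtTwoAdditiveKatoFineDescentAtTwoSharp
import Literature.NumberTheory.EllipticCurves.FineSelmerClassGroupCriterion
import HarnessLib

/-!
# Route `ByReductionTypeAtTwo` (rung K4), crux `AdditiveRankZeroAtTwo` (item stmt-BirchSwinnertonDyer-19098),
# line add_twist_overK v2, stub `stub_addDefectUpper` (hU3): DISCHARGING the hypothesis «statement (A) at (E, 2)» of the
# sharp doors BY NAME — class-group certificate (Fukuda 1994 Thm 1 (2), any layer n₀) or an ABELIAN admissible subfield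
# (Ferrero–Washington) — through Lim 2017 Thm 3.5 at p = 2; generic in the curve (a `--supports` file; seat
# `bsd-2adic-addL2x` GEN 8; sequel of `…AdditiveKatoFineDescentAtTwoSharp.lean`; outside the route file's import cone)

HONEST FRAMING (cell `bsd-2adic`, HUMAN RULING D-0036/D-0054): types-the-object-of; closes none at the ∀-level;
nothing booked; BSD is not proved by any of this. Conditional helpers (no class data inside; nothing asserted).

WHAT THIS FILE DOES. The sharp doors (`missingUpperBoundAt_two_of_katoFineSelmerAtTwoSharp`, …) carry ONE displayed
non-print hypothesis per curve: Coates–Sujatha's statement (A) at `(E, 2)` (`hA`, the `∃ γ D` finite-generation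
statement). The tree holds two PRINT roads to it: Lim 2017 Thm. 3.5 with Lemma 3.2 AT `p = 2`
(`Lim2017.thm35_at_two_fineSelmerDual_moduleFinite_of_classicalMuVanishes_of_le_divisionField_four`, p569733: (A)`(E,2)` ⟸
Iwasawa's classical `μ₂ = 0` for a subfield `L ≤ ℚ(E[4])` of `2`-power index — by its 2026-08-28 scope rider the honest
witnesses are `L` totally imaginary, or `r₁(L) = 1` with `L ∩ ℚ^cyc = ℚ`, e.g. `L = ℚ(e₁, i)` or, for `Δ_E < 0`, the
cubic field `ℚ(e₁)`), fed EITHER by Fukuda 1994 Thm. 1 (2) (`fukuda1994_thm1_classGroupPRank_const_of_succ_eq`: total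
ramification from layer `n₀` and `rank₂ Cl(L_{n₀+1}) = rank₂ Cl(L_{n₀})` ⇒ `μ₂ = 0`; a finite CLASS-GROUP CERTIFICATE)
OR by Ferrero–Washington (`ferreroWashington1979_classicalMuVanishes`: `L/ℚ` ABELIAN ⇒ `μ = 0`; e.g. the cyclic-cubic
`2`-division fields and their compositum with `ℚ(i)`). GEN 5's rung `bsdp_two_8092j1_of_fukudaCertificate` (p570906)
did this inline for ONE curve at `n₀ = 0`; this file does it ONCE for every curve and every `n₀`, and composes with the
SHARP doors (no evenness of `ord₂ #Ш_an` on the upper side any more), so that a per-class file needs only decide-level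
class facts and the displayed certificate.

* §1 `conjA_two_of_fukudaCertificate` — (A)`(W,2)` ⟸ Lim@2 + Fukuda + CERT {`L ≤ ℚ(E[4])`, `2`-power index, layer `n₀`
  with total ramification and equal `2`-ranks}; `conjA_two_of_abelianSubfield` — (A)`(W,2)` ⟸ Lim@2 + FW + {abelian
  `L ≤ ℚ(E[4])` of `2`-power index}.
* §2 `missingUpperBoundAt_two_of_fukudaCertificate` / `…_of_abelianSubfield` — hU3 AT A CURVE of {E[2] irreducible}
  from PRINT + READING + CERTIFICATE (no conjecture displayed).
* §3 `bsdp_two_of_fukudaCertificate_of_lowerCertificate` / `…_of_abelianSubfield_of_lowerCertificate` — the per-class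
  TEMPLATE: `BSD₂(W)` ⟸ {hSharp, hGZK, hmod, hCT, hLim2, hFuk | hFW} + CERT_A + CERT_lower
  (`#Ш_an = q`, `ord₂ q ≤ 2k`, `2^{2k−1} ∣ #Ш`) + class facts {¬CM, `r_an = 0`, defect ≥ 3, `E[2]` irreducible}.
* §4 `addDefectUpper_irreducible_of_fukudaCertificates` — ∀ SHAPE: on {irreducible}, `stub_addDefectUpper` ⟸ «every
  curve of the sub-block admits a Fukuda certificate field» — the conjecture (A) re-typed as a concrete class-group
  statement about subfields of `ℚ(E[4])` (decidable per curve; 846/1 145 block classes certified by GEN 5's kits, more by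
  GEN 8's).

Binders BY NAME: `hSharp` (Literature, flagged `…-sharp`), `hLim2` (PRINT, D-audit hLim35@2 PASS), `hFuk` (PRINT, D-audit
hFuk PASS), `hFW` (PRINT), `hGZK`, `hmod`, `hCT`. References: [Lim2017FineSelmer] Thm. 3.5, Lemma 3.2; [Fukuda1994] Thm. 1 (2);
[FerreroWashington1979]; [CoatesSujatha2005] statement (A), Thm. 3.4; [Kato2004Asterisque] Thm. 12.5; [Miller2011LMS] Def. 1.1.
-/

set_option autoImplicit false
-- sibling precedent (`ByReductionTypeAtTwoAdditiveKatoFineDescentAtTwoSharp.lean`): the directory name repeats the summit name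
set_option linter.dupNamespace false

noncomputable section

open scoped Classical

namespace Summit.BirchSwinnertonDyer.BirchSwinnertonDyer.Theorems.AddKatoTwo

open WeierstrassCurve Literature.NumberTheory.EllipticCurves
  Literature.NumberTheory.EllipticCurves.Rank1Residual
  Literature.NumberTheory.EllipticCurves.Rank1Residual.Typed
  Literature.NumberTheory.IwasawaTheory
  Summit.BirchSwinnertonDyer.Rank1Residual.AdditivePotMult
  Summit.BirchSwinnertonDyer.Rank1Residual.X5.AddTwoL2

/-! ## §1 Statement (A) at `(E, 2)` from a certificate, BY NAME -/

/-- **(A)`(W,2)` from a Fukuda class-group certificate.** Granted Lim 2017 Thm. 3.5 + Lemma 3.2 at `p = 2` (`hLim2`) and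
Fukuda 1994 Thm. 1 (2) (`hFuk`): if `L ≤ ℚ(E[4])` has `2`-power index and, for every cyclotomic `ℤ₂`-extension datum
`κL` of `L`, the layer `n₀` is totally-ramified-from and `rank₂ Cl(L_{n₀+1}) = rank₂ Cl(L_{n₀})` (the CERTIFICATE,
`hcert`), then the dual fine Selmer group of `E` over `ℚ^cyc` is `ℤ₂`-finitely generated — statement (A) at `(E,2)` in
the `∃ γ D` spelling. Generic form of the inline step of `bsdp_two_8092j1_of_fukudaCertificate` (any curve, any `n₀`).
[cite: Lim2017FineSelmer, §3 Thm. 3.5 and Lemma 3.2] [cite: Fukuda1994, Thm. 1 (2), p. 264]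
[cite: CoatesSujatha2005, statement (A) and Thm. 3.4] -/
theorem conjA_two_of_fukudaCertificate
    (hLim2 : Lim2017.thm35_at_two_fineSelmerDual_moduleFinite_of_classicalMuVanishes_of_le_divisionField_four)
    (hFuk : fukuda1994_thm1_classGroupPRank_const_of_succ_eq)
    (W : WeierstrassCurve ℚ) [W.IsElliptic]
    (L : IntermediateField ℚ (AlgebraicClosure ℚ)) (hL : L ≤ W.divisionField 4)
    (hdeg : ∃ k : ℕ, Module.finrank ℚ (W.divisionField 4) = 2 ^ k * Module.finrank ℚ L) (n₀ : ℕ)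
    (hcert : ∀ κL : ZpExtension L 2, κL.IsCyclotomic →
      TotallyRamifiedFrom κL n₀ ∧ classGroupPRank κL (n₀ + 1) = classGroupPRank κL n₀) :
    ∀ (κ : ZpExtension ℚ 2), κ.IsCyclotomic →
      ∃ (γ : Field.absoluteGaloisGroup ℚ) (D : W.FineSelmerDualData κ γ),
        Module.Finite ℤ_[2] (RestrictScalars ℤ_[2] (IwasawaAlgebra 2) D.X) := by
  refine hLim2 W L hL hdeg ?_
  intro κL hκL
  -- `L ≤ ℚ(E[4])` is a number field (finite over `ℚ`)
  haveI : FiniteDimensional ℚ L :=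
    FiniteDimensional.of_injective (IntermediateField.inclusion hL).toLinearMap (IntermediateField.inclusion_injective hL)
  haveI : NumberField L := NumberField.mk
  exact (hFuk L 2 κL n₀ (hcert κL hκL).1 n₀ le_rfl (hcert κL hκL).2).2

/-- **(A)`(W,2)` from an ABELIAN admissible subfield.** Granted Lim@2 (`hLim2`) and Ferrero–Washington (`hFW`): if some
`L ≤ ℚ(E[4])` of `2`-power index is abelian over `ℚ` (e.g. `ℚ(e₁, i)` when the `2`-division cubic is cyclic), then
statement (A) holds at `(E,2)`. No class-group data needed. [cite: Lim2017FineSelmer, §3 Thm. 3.5 and Lemma 3.2]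
[cite: FerreroWashington1979, Theorem (μ = 0 for abelian fields)] [cite: CoatesSujatha2005, statement (A) and Thm. 3.4] -/
theorem conjA_two_of_abelianSubfield
    (hLim2 : Lim2017.thm35_at_two_fineSelmerDual_moduleFinite_of_classicalMuVanishes_of_le_divisionField_four)
    (hFW : ferreroWashington1979_classicalMuVanishes)
    (W : WeierstrassCurve ℚ) [W.IsElliptic]
    (L : IntermediateField ℚ (AlgebraicClosure ℚ)) [IsAbelianGalois ℚ L] (hL : L ≤ W.divisionField 4)
    (hdeg : ∃ k : ℕ, Module.finrank ℚ (W.divisionField 4) = 2 ^ k * Module.finrank ℚ L) :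
    ∀ (κ : ZpExtension ℚ 2), κ.IsCyclotomic →
      ∃ (γ : Field.absoluteGaloisGroup ℚ) (D : W.FineSelmerDualData κ γ),
        Module.Finite ℤ_[2] (RestrictScalars ℤ_[2] (IwasawaAlgebra 2) D.X) := by
  refine hLim2 W L hL hdeg ?_
  intro κL hκL
  haveI : FiniteDimensional ℚ L :=
    FiniteDimensional.of_injective (IntermediateField.inclusion hL).toLinearMap (IntermediateField.inclusion_injective hL)
  haveI : NumberField L := NumberField.mk
  haveI : Fact (Nat.Prime 2) := ⟨Nat.prime_two⟩
  exact hFW L 2 κL hκL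

/-! ## §2 hU3 AT A CURVE from PRINT + READING + CERTIFICATE (no conjecture displayed) -/

/-- **hU3 at a curve of the sub-block {E[2] irreducible} from a Fukuda certificate.** `MissingUpperBoundAt W 2` for a non-CM
`r_an = 0` curve of the defect-≥3 block with irreducible `E[2]`, from the SHARP reading, GZK, modularity, Lim@2, Fukuda and the
displayed certificate (`L`, `hL`, `hdeg`, `n₀`, `hcert`). [cite: Kato2004Asterisque, Thm. 12.5 (1)(3) (pp. 221–222)]
[cite: Lim2017FineSelmer, §3 Thm. 3.5] [cite: Fukuda1994, Thm. 1 (2)] [cite: Miller2011LMS, Def. 1.1] -/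
theorem missingUpperBoundAt_two_of_fukudaCertificate
    (hSharp : Kato2004.rankZero_padicValNat_sha_add_padicValNat_tamagawa_le_at_two_of_irreducible_of_fineSelmerDual_fg)
    (hGZK : rank_eq_analyticRank_of_analyticRank_le_one) (hmod : hasEntireLFunction_rat)
    (hLim2 : Lim2017.thm35_at_two_fineSelmerDual_moduleFinite_of_classicalMuVanishes_of_le_divisionField_four)
    (hFuk : fukuda1994_thm1_classGroupPRank_const_of_succ_eq)
    (W : WeierstrassCurve ℚ) [W.IsElliptic] [W.IsGloballyMinimal] (hcm : ¬ W.HasCM) (hr : W.analyticRank = 0)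
    (hdef : DefectAtLeastThree W) (hirr : W.HasIrreducibleModPGaloisRep 2)
    (L : IntermediateField ℚ (AlgebraicClosure ℚ)) (hL : L ≤ W.divisionField 4)
    (hdeg : ∃ k : ℕ, Module.finrank ℚ (W.divisionField 4) = 2 ^ k * Module.finrank ℚ L) (n₀ : ℕ)
    (hcert : ∀ κL : ZpExtension L 2, κL.IsCyclotomic →
      TotallyRamifiedFrom κL n₀ ∧ classGroupPRank κL (n₀ + 1) = classGroupPRank κL n₀) :
    MissingUpperBoundAt W 2 :=
  missingUpperBoundAt_two_of_katoFineSelmerAtTwoSharp hSharp hGZK hmod W hcm hr hdef hirr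
    (conjA_two_of_fukudaCertificate hLim2 hFuk W L hL hdeg n₀ hcert)

/-- **hU3 at a curve of the sub-block {E[2] irreducible} from an abelian admissible subfield** (PRINT only, beyond the
reading: FW + Lim@2). [cite: Kato2004Asterisque, Thm. 12.5 (1)(3) (pp. 221–222)] [cite: Lim2017FineSelmer, §3 Thm. 3.5]
[cite: FerreroWashington1979, Theorem] [cite: Miller2011LMS, Def. 1.1] -/
theorem missingUpperBoundAt_two_of_abelianSubfield
    (hSharp : Kato2004.rankZero_padicValNat_sha_add_padicValNat_tamagawa_le_at_two_of_irreducible_of_fineSelmerDual_fg)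
    (hGZK : rank_eq_analyticRank_of_analyticRank_le_one) (hmod : hasEntireLFunction_rat)
    (hLim2 : Lim2017.thm35_at_two_fineSelmerDual_moduleFinite_of_classicalMuVanishes_of_le_divisionField_four)
    (hFW : ferreroWashington1979_classicalMuVanishes)
    (W : WeierstrassCurve ℚ) [W.IsElliptic] [W.IsGloballyMinimal] (hcm : ¬ W.HasCM) (hr : W.analyticRank = 0)
    (hdef : DefectAtLeastThree W) (hirr : W.HasIrreducibleModPGaloisRep 2)
    (L : IntermediateField ℚ (AlgebraicClosure ℚ)) [IsAbelianGalois ℚ L] (hL : L ≤ W.divisionField 4)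
    (hdeg : ∃ k : ℕ, Module.finrank ℚ (W.divisionField 4) = 2 ^ k * Module.finrank ℚ L) :
    MissingUpperBoundAt W 2 :=
  missingUpperBoundAt_two_of_katoFineSelmerAtTwoSharp hSharp hGZK hmod W hcm hr hdef hirr
    (conjA_two_of_abelianSubfield hLim2 hFW W L hL hdeg)

/-! ## §3 The per-class TEMPLATE: BSD₂ from PRINT + READING + the two certificates -/

/-- **Per-class template, Fukuda form: `BSD₂(W)` from the SHARP reading, PRINT {GZK, modularity, Cassels–Tate, Lim@2, Fukuda},
class facts {¬CM, `r_an = 0`, defect ≥ 3, `E[2]` irreducible}, CERT_A {`L`, `hL`, `hdeg`, `n₀`, `hcert`} and CERT_lower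
{`#Ш_an = q`, `ord₂ q ≤ 2k`, `2^{2k−1} ∣ #Ш`}.** Upper half `missingUpperBoundAt_two_of_fukudaCertificate`, lower half
`missingLowerBoundAt_of_casselsTate_of_pow_dvd`. The generic form of GEN 5's rung `bsdp_two_8092j1_of_fukudaCertificate` with the
evenness requirement on the UPPER side gone (sharp reading). [cite: Kato2004Asterisque, Thm. 12.5 (1)(3) (pp. 221–222)]
[cite: Lim2017FineSelmer, §3 Thm. 3.5] [cite: Fukuda1994, Thm. 1 (2)] [cite: SilvermanAEC2009, Thm. X.4.14]
[cite: Miller2011LMS, §1 and Def. 1.1] -/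
theorem bsdp_two_of_fukudaCertificate_of_lowerCertificate
    (hSharp : Kato2004.rankZero_padicValNat_sha_add_padicValNat_tamagawa_le_at_two_of_irreducible_of_fineSelmerDual_fg)
    (hGZK : rank_eq_analyticRank_of_analyticRank_le_one) (hmod : hasEntireLFunction_rat)
    (hCT : exists_casselsTate_pairing (K := ℚ))
    (hLim2 : Lim2017.thm35_at_two_fineSelmerDual_moduleFinite_of_classicalMuVanishes_of_le_divisionField_four)
    (hFuk : fukuda1994_thm1_classGroupPRank_const_of_succ_eq)
    (W : WeierstrassCurve ℚ) [W.IsElliptic] [W.IsGloballyMinimal] (hcm : ¬ W.HasCM) (hr : W.analyticRank = 0)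
    (hdef : DefectAtLeastThree W) (hirr : W.HasIrreducibleModPGaloisRep 2)
    (L : IntermediateField ℚ (AlgebraicClosure ℚ)) (hL : L ≤ W.divisionField 4)
    (hdeg : ∃ k : ℕ, Module.finrank ℚ (W.divisionField 4) = 2 ^ k * Module.finrank ℚ L) (n₀ : ℕ)
    (hcert : ∀ κL : ZpExtension L 2, κL.IsCyclotomic →
      TotallyRamifiedFrom κL n₀ ∧ classGroupPRank κL (n₀ + 1) = classGroupPRank κL n₀)
    {q : ℚ} (hq : shaAn W = (q : ℂ)) {k : ℕ} (hk : padicValRat 2 q ≤ 2 * k) (hdvd : 2 ^ (2 * k - 1) ∣ W.shaOrder) :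
    BSDp W 2 :=
  bsdp_two_of_katoFineSelmerAtTwoSharp_of_certificates hSharp hGZK hmod hCT W hcm hr hdef hirr
    (conjA_two_of_fukudaCertificate hLim2 hFuk W L hL hdeg n₀ hcert) hq hk hdvd

/-- **Per-class template, abelian form** (cyclic-cubic `2`-division field and the like): as the Fukuda form with FW in place of
the class-group certificate. [cite: Kato2004Asterisque, Thm. 12.5 (1)(3) (pp. 221–222)] [cite: Lim2017FineSelmer, §3 Thm. 3.5]
[cite: FerreroWashington1979, Theorem] [cite: SilvermanAEC2009, Thm. X.4.14] [cite: Miller2011LMS, §1 and Def. 1.1] -/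
theorem bsdp_two_of_abelianSubfield_of_lowerCertificate
    (hSharp : Kato2004.rankZero_padicValNat_sha_add_padicValNat_tamagawa_le_at_two_of_irreducible_of_fineSelmerDual_fg)
    (hGZK : rank_eq_analyticRank_of_analyticRank_le_one) (hmod : hasEntireLFunction_rat)
    (hCT : exists_casselsTate_pairing (K := ℚ))
    (hLim2 : Lim2017.thm35_at_two_fineSelmerDual_moduleFinite_of_classicalMuVanishes_of_le_divisionField_four)
    (hFW : ferreroWashington1979_classicalMuVanishes)
    (W : WeierstrassCurve ℚ) [W.IsElliptic] [W.IsGloballyMinimal] (hcm : ¬ W.HasCM) (hr : W.analyticRank = 0)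
    (hdef : DefectAtLeastThree W) (hirr : W.HasIrreducibleModPGaloisRep 2)
    (L : IntermediateField ℚ (AlgebraicClosure ℚ)) [IsAbelianGalois ℚ L] (hL : L ≤ W.divisionField 4)
    (hdeg : ∃ k : ℕ, Module.finrank ℚ (W.divisionField 4) = 2 ^ k * Module.finrank ℚ L)
    {q : ℚ} (hq : shaAn W = (q : ℂ)) {k : ℕ} (hk : padicValRat 2 q ≤ 2 * k) (hdvd : 2 ^ (2 * k - 1) ∣ W.shaOrder) :
    BSDp W 2 :=
  bsdp_two_of_katoFineSelmerAtTwoSharp_of_certificates hSharp hGZK hmod hCT W hcm hr hdef hirr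
    (conjA_two_of_abelianSubfield hLim2 hFW W L hL hdeg) hq hk hdvd

/-! ## §4 The ∀ shape: statement (A) on the sub-block RE-TYPED as the existence of a certificate field per curve -/

/-- **`stub_addDefectUpper` on the sub-block {E[2] irreducible} from «every curve admits a Fukuda certificate field».** Granted the
SHARP reading, GZK, modularity, Lim@2 and Fukuda (all BY NAME): IF for every non-CM `r_an = 0` curve `W` of the defect-≥3 block with
irreducible `E[2]` there are a subfield `L ≤ ℚ(E[4])` of `2`-power index and a layer `n₀` from which every cyclotomic `ℤ₂`-tower of `L`
is totally ramified with `rank₂ Cl(L_{n₀+1}) = rank₂ Cl(L_{n₀})` (hypothesis `hcerts` — a concrete class-group statement, weaker than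
Iwasawa's `μ = 0` conjecture for these fields, decidable curve by curve), THEN `MissingUpperBoundAt W 2` for every such `W`. Conditional;
nothing asserted. [cite: Lim2017FineSelmer, §3 Thm. 3.5] [cite: Fukuda1994, Thm. 1 (2)] [cite: Kato2004Asterisque, Thm. 12.5 (1)(3)]
[cite: Miller2011LMS, Def. 1.1] -/
theorem addDefectUpper_irreducible_of_fukudaCertificates
    (hSharp : Kato2004.rankZero_padicValNat_sha_add_padicValNat_tamagawa_le_at_two_of_irreducible_of_fineSelmerDual_fg)
    (hGZK : rank_eq_analyticRank_of_analyticRank_le_one) (hmod : hasEntireLFunction_rat)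
    (hLim2 : Lim2017.thm35_at_two_fineSelmerDual_moduleFinite_of_classicalMuVanishes_of_le_divisionField_four)
    (hFuk : fukuda1994_thm1_classGroupPRank_const_of_succ_eq)
    (hcerts : ∀ (W : WeierstrassCurve ℚ) [W.IsElliptic] [W.IsGloballyMinimal], ¬ W.HasCM → W.analyticRank = 0 →
      DefectAtLeastThree W → W.HasIrreducibleModPGaloisRep 2 →
      ∃ (L : IntermediateField ℚ (AlgebraicClosure ℚ)) (n₀ : ℕ), L ≤ W.divisionField 4 ∧
        (∃ k : ℕ, Module.finrank ℚ (W.divisionField 4) = 2 ^ k * Module.finrank ℚ L) ∧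
        ∀ κL : ZpExtension L 2, κL.IsCyclotomic →
          TotallyRamifiedFrom κL n₀ ∧ classGroupPRank κL (n₀ + 1) = classGroupPRank κL n₀) :
    ∀ (W : WeierstrassCurve ℚ) [W.IsElliptic] [W.IsGloballyMinimal], ¬ W.HasCM → W.analyticRank = 0 →
      DefectAtLeastThree W → W.HasIrreducibleModPGaloisRep 2 → MissingUpperBoundAt W 2 := by
  intro W _ _ hcm hr hdef hirr
  obtain ⟨L, n₀, hL, hdeg, hcert⟩ := hcerts W hcm hr hdef hirr
  exact missingUpperBoundAt_two_of_fukudaCertificate hSharp hGZK hmod hLim2 hFuk W hcm hr hdef hirr L hL hdeg n₀ hcert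

end Summit.BirchSwinnertonDyer.BirchSwinnertonDyer.Theorems.AddKatoTwo


/-! ## §5 APPEND (same seat, same GEN): the per-class templates keyed on «additive + potentially good at 2» instead of
`DefectAtLeastThree` (what a class file decides at kernel level: `¬ Good`, `¬ Mult` from the minimal model, `0 ≤ ord₂ j` from
`2⁴ ∣ c₄`-type valuations — as GEN 5's rung `bsdp_two_8092j1_of_conjA` did; `DefectAtLeastThree` implies them by
`quadSemistabilisable_of_potMult` but is itself not needed by the reading) -/

namespace Summit.BirchSwinnertonDyer.BirchSwinnertonDyer.Theorems.AddKatoTwo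

open WeierstrassCurve Literature.NumberTheory.EllipticCurves
  Literature.NumberTheory.EllipticCurves.Rank1Residual
  Literature.NumberTheory.EllipticCurves.Rank1Residual.Typed
  Literature.NumberTheory.IwasawaTheory

/-- **hU3 at a curve, potentially-good form**: `MissingUpperBoundAt W 2` for a non-CM globally minimal `W`, ADDITIVE and
POTENTIALLY GOOD at `2` (`hgood`, `hmult`, `hpot`), `E[2]` irreducible, `r_an = 0`, granted statement (A) at `(W,2)` — through the
SHARP reading (`padicValNat_shaOrder_le_of_katoFineSelmerAtTwoSharp_rankZero`; torsion term `0` by irreducibility). No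
Cassels–Tate, no parity. [cite: Kato2004Asterisque, Thm. 12.5 (1)(3) (pp. 221–222), 13.8 (pp. 227–229), 14.14 (p. 243)]
[cite: CoatesSujatha2005, statement (A)] [cite: Miller2011LMS, Def. 1.1] -/
theorem missingUpperBoundAt_two_of_katoFineSelmerAtTwoSharp_potGood
    (hSharp : Kato2004.rankZero_padicValNat_sha_add_padicValNat_tamagawa_le_at_two_of_irreducible_of_fineSelmerDual_fg)
    (hGZK : rank_eq_analyticRank_of_analyticRank_le_one) (hmod : hasEntireLFunction_rat)
    (W : WeierstrassCurve ℚ) [W.IsElliptic] [W.IsGloballyMinimal] (hcm : ¬ W.HasCM) (hr : W.analyticRank = 0)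
    (hgood : ¬ W.HasGoodReductionAtPrime 2) (hmult : ¬ W.HasMultiplicativeReductionAtPrime 2)
    (hpot : 0 ≤ padicValRat 2 W.j) (hirr : W.HasIrreducibleModPGaloisRep 2)
    (hA : ∀ (κ : ZpExtension ℚ 2), κ.IsCyclotomic →
      ∃ (γ : Field.absoluteGaloisGroup ℚ) (D : W.FineSelmerDualData κ γ),
        Module.Finite ℤ_[2] (RestrictScalars ℤ_[2] (IwasawaAlgebra 2) D.X)) :
    MissingUpperBoundAt W 2 := by
  obtain ⟨q, hq, hle⟩ :=
    padicValNat_shaOrder_le_of_katoFineSelmerAtTwoSharp_rankZero hSharp hGZK hmod W hcm hgood hmult hpot hirr hA hr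
  rw [padicValNat_torsionOrder_eq_zero_of_irreducible W 2 hirr] at hle
  simp only [Nat.cast_zero, mul_zero, sub_zero] at hle
  exact ⟨q, hq, hle⟩

/-- **Per-class template, Fukuda form, potentially-good keying: `BSD₂(W)` ⟸ PRINT {hSharp (reading), hGZK, hmod, hCT, hLim2,
hFuk} + class facts {¬CM, `r_an = 0`, additive + potentially good at `2`, `E[2]` irreducible} + CERT_A {`L ≤ ℚ(E[4])` of `2`-power
index, layer `n₀`, total ramification, equal `2`-ranks} + CERT_lower {`#Ш_an = q`, `ord₂ q ≤ 2k`, `2^{2k−1} ∣ #Ш`}.** The shape a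
generated class file instantiates (one `decide`-level fact per class hypothesis; the certificates displayed).
[cite: Kato2004Asterisque, Thm. 12.5 (1)(3) (pp. 221–222)] [cite: Lim2017FineSelmer, §3 Thm. 3.5 and Lemma 3.2]
[cite: Fukuda1994, Thm. 1 (2), p. 264] [cite: SilvermanAEC2009, Thm. X.4.14] [cite: Miller2011LMS, §1 and Def. 1.1] -/
theorem bsdp_two_of_fukudaCertificate_of_lowerCertificate_potGood
    (hSharp : Kato2004.rankZero_padicValNat_sha_add_padicValNat_tamagawa_le_at_two_of_irreducible_of_fineSelmerDual_fg)
    (hGZK : rank_eq_analyticRank_of_analyticRank_le_one) (hmod : hasEntireLFunction_rat)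
    (hCT : exists_casselsTate_pairing (K := ℚ))
    (hLim2 : Lim2017.thm35_at_two_fineSelmerDual_moduleFinite_of_classicalMuVanishes_of_le_divisionField_four)
    (hFuk : fukuda1994_thm1_classGroupPRank_const_of_succ_eq)
    (W : WeierstrassCurve ℚ) [W.IsElliptic] [W.IsGloballyMinimal] (hcm : ¬ W.HasCM) (hr : W.analyticRank = 0)
    (hgood : ¬ W.HasGoodReductionAtPrime 2) (hmult : ¬ W.HasMultiplicativeReductionAtPrime 2)
    (hpot : 0 ≤ padicValRat 2 W.j) (hirr : W.HasIrreducibleModPGaloisRep 2)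
    (L : IntermediateField ℚ (AlgebraicClosure ℚ)) (hL : L ≤ W.divisionField 4)
    (hdeg : ∃ k : ℕ, Module.finrank ℚ (W.divisionField 4) = 2 ^ k * Module.finrank ℚ L) (n₀ : ℕ)
    (hcert : ∀ κL : ZpExtension L 2, κL.IsCyclotomic →
      TotallyRamifiedFrom κL n₀ ∧ classGroupPRank κL (n₀ + 1) = classGroupPRank κL n₀)
    {q : ℚ} (hq : shaAn W = (q : ℂ)) {k : ℕ} (hk : padicValRat 2 q ≤ 2 * k) (hdvd : 2 ^ (2 * k - 1) ∣ W.shaOrder) :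
    BSDp W 2 := by
  have hr1 : W.analyticRank ≤ 1 := by rw [hr]; exact zero_le_one
  have hfin : W.ShaFinite := (hGZK W hr1).2
  exact bsdp_of_missingPPartAt W 2 hGZK hr1
    (missingPPartAt_of_lower_of_upper W 2
      (missingLowerBoundAt_of_casselsTate_of_pow_dvd W 2 hCT hfin hq hk hdvd)
      (missingUpperBoundAt_two_of_katoFineSelmerAtTwoSharp_potGood hSharp hGZK hmod W hcm hr hgood hmult hpot hirr
        (conjA_two_of_fukudaCertificate hLim2 hFuk W L hL hdeg n₀ hcert)))

/-- **Per-class template, abelian form, potentially-good keying** (cyclic-cubic `2`-division field): Ferrero–Washington in place of the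
class-group certificate. [cite: Kato2004Asterisque, Thm. 12.5 (1)(3) (pp. 221–222)] [cite: Lim2017FineSelmer, §3 Thm. 3.5 and Lemma 3.2]
[cite: FerreroWashington1979, Theorem] [cite: SilvermanAEC2009, Thm. X.4.14] [cite: Miller2011LMS, §1 and Def. 1.1] -/
theorem bsdp_two_of_abelianSubfield_of_lowerCertificate_potGood
    (hSharp : Kato2004.rankZero_padicValNat_sha_add_padicValNat_tamagawa_le_at_two_of_irreducible_of_fineSelmerDual_fg)
    (hGZK : rank_eq_analyticRank_of_analyticRank_le_one) (hmod : hasEntireLFunction_rat)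
    (hCT : exists_casselsTate_pairing (K := ℚ))
    (hLim2 : Lim2017.thm35_at_two_fineSelmerDual_moduleFinite_of_classicalMuVanishes_of_le_divisionField_four)
    (hFW : ferreroWashington1979_classicalMuVanishes)
    (W : WeierstrassCurve ℚ) [W.IsElliptic] [W.IsGloballyMinimal] (hcm : ¬ W.HasCM) (hr : W.analyticRank = 0)
    (hgood : ¬ W.HasGoodReductionAtPrime 2) (hmult : ¬ W.HasMultiplicativeReductionAtPrime 2)
    (hpot : 0 ≤ padicValRat 2 W.j) (hirr : W.HasIrreducibleModPGaloisRep 2)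
    (L : IntermediateField ℚ (AlgebraicClosure ℚ)) [IsAbelianGalois ℚ L] (hL : L ≤ W.divisionField 4)
    (hdeg : ∃ k : ℕ, Module.finrank ℚ (W.divisionField 4) = 2 ^ k * Module.finrank ℚ L)
    {q : ℚ} (hq : shaAn W = (q : ℂ)) {k : ℕ} (hk : padicValRat 2 q ≤ 2 * k) (hdvd : 2 ^ (2 * k - 1) ∣ W.shaOrder) :
    BSDp W 2 := by
  have hr1 : W.analyticRank ≤ 1 := by rw [hr]; exact zero_le_one
  have hfin : W.ShaFinite := (hGZK W hr1).2
  exact bsdp_of_missingPPartAt W 2 hGZK hr1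
    (missingPPartAt_of_lower_of_upper W 2
      (missingLowerBoundAt_of_casselsTate_of_pow_dvd W 2 hCT hfin hq hk hdvd)
      (missingUpperBoundAt_two_of_katoFineSelmerAtTwoSharp_potGood hSharp hGZK hmod W hcm hr hgood hmult hpot hirr
        (conjA_two_of_abelianSubfield hLim2 hFW W L hL hdeg)))

end Summit.BirchSwinnertonDyer.BirchSwinnertonDyer.Theorems.AddKatoTwo

end
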